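import Literature.RingTheory.Flat.SmallExtensionBaseChange
import Mathlib.RingTheory.LocalRing.ResidueField.Basic
import Mathlib.Algebra.Module.Torsion.Basic
import Mathlib.RingTheory.Noetherian.Basic
import Mathlib.LinearAlgebra.Dimension.Free
import Mathlib.LinearAlgebra.Basis.VectorSpace
import Mathlib.RingTheory.Ideal.Quotient.Noetherian
import HarnessLib

/-!
# The tower `O/𝔪 ← O/𝔪² ← O/𝔪³ ← ⋯` of a noetherian local ring: each step is a small extension with framed kernel

Layer `Literature/RingTheory/Flat`, namespace `Literature.RingTheory.Flat`.  THEOREMS ONLY (no definition, no named fact, no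
instance, no notation).  Cell `hodgecm-mathlib` (D-0151), F-2d road (R-def) «theorem of the cube over a non-reduced base»,
brick D5a (author B-p07 (g16)); also the Artinian towers of the deformation road F-11.

For a noetherian local ring `(O, 𝔪, κ)` which is an algebra over a base ring `Λ` (e.g. `Λ = O`, or `Λ = Γ(B, 𝒪_T)` and
`O = 𝒪_{T,t}`), the surjections `π_n : O/𝔪^{n+2} → O/𝔪^{n+1}` and `ρ_n : O/𝔪^{n+1} → κ` (Mathlib `Ideal.Quotient.factorₐ`)
form, for every `n`, a SMALL EXTENSION WITH FRAMED KERNEL in the sense of ★ `Literature.RingTheory.Flat.IsSmallExtension`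
(`SmallExtensionBaseChange`): `ker π_n = I_n = 𝔪^{n+1}/𝔪^{n+2}` is killed by `𝔪`, hence a finite-dimensional `κ`-vector
space, and a basis gives `e_n : κ^{d_n} ≅ I_n`, `Λ`-linear and compatible with the `O/𝔪^{n+2}`-action through `ρ_{n+1}`.
This is the algebra of ★ `Motives/ThickeningTower` (M13, typed there for the stalk of a `K`-scheme at a point, `K` a field)
for an ABSTRACT noetherian local `Λ`-algebra — the form consumed by ★ `Morphisms/CechUnitCocycleTwoFaceTower`
(`forall_exists_rel_of_tower`, hypotheses `Hn`, `hρn`) at `O = 𝒪_{T,t}` for a locally noetherian base `T` of any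
characteristic, with no field around ([GortzWedhorn2023] Lemma 24.72, proof: «by induction on the length of `A`» through the
quotients `𝒪_{S,s}/𝔪^n`).

* (private) `maximalIdeal_pow_succ_le`, `maximalIdeal_pow_succ_le_maximalIdeal` — the inequalities defining `π_n`, `ρ_n`
  (consumers spell `Ideal.pow_le_pow_right (Nat.le_succ _)` / `Ideal.pow_le_self (Nat.succ_ne_zero _)`, any proof works);
* `factorₐ_residue_comp_factorₐ` — `ρ_n ∘ π_n = ρ_{n+1}`;
* **`exists_isSmallExtension_powQuot`** — `∃ d e, IsSmallExtension π_n ρ_{n+1} (𝔪^{n+1}/𝔪^{n+2}) e`.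

HC_CM is proved only modulo the 7 printed citations until rung 0 closes; nothing here is about HC.

## References
* [GortzWedhorn2023] U. Görtz, T. Wedhorn, *Algebraic Geometry II* (2023), Lemma 24.72, proof, Step (I) (p. 409).
* [StacksProject] The Stacks Project, Tag 00HL (flatness), Tag 06GD (small extensions in deformation theory).
-/

noncomputable section

universe u

open IsLocalRing

namespace Literature.RingTheory.Flat

variable (Λ : Type u) [CommRing Λ] (O : Type u) [CommRing O] [Algebra Λ O] [IsLocalRing O]

/-- `𝔪^{n+2} ≤ 𝔪^{n+1}` (the inequality defining `π_n : O/𝔪^{n+2} → O/𝔪^{n+1}`; private plumbing). [folklore] -/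
private theorem maximalIdeal_pow_succ_le (n : ℕ) : maximalIdeal O ^ (n + 1 + 1) ≤ maximalIdeal O ^ (n + 1) :=
  Ideal.pow_le_pow_right (Nat.le_succ _)

/-- `𝔪^{n+1} ≤ 𝔪` (the inequality defining `ρ_n : O/𝔪^{n+1} → κ = O/𝔪`; private plumbing). [folklore] -/
private theorem maximalIdeal_pow_succ_le_maximalIdeal (n : ℕ) : maximalIdeal O ^ (n + 1) ≤ maximalIdeal O :=
  Ideal.pow_le_self (Nat.succ_ne_zero n)

/-- **`ρ_n ∘ π_n = ρ_{n+1}`** for `π_n : O/𝔪^{n+2} → O/𝔪^{n+1}`, `ρ_n : O/𝔪^{n+1} → κ` (Mathlib `Ideal.Quotient.factorₐ_comp`):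
the compatibility of the tower `⋯ → 𝒪/𝔪^{n+2} → 𝒪/𝔪^{n+1} → ⋯ → κ` of [GortzWedhorn2023] Lemma 24.72's induction with the residue
maps (hypothesis `hρn` of ★ `forall_exists_rel_of_tower`). [cite: GortzWedhorn2023, Lemma 24.72 proof Step (I) (p. 409)] -/
theorem factorₐ_residue_comp_factorₐ (n : ℕ) :
    (Ideal.Quotient.factorₐ Λ (maximalIdeal_pow_succ_le_maximalIdeal O n)).comp
      (Ideal.Quotient.factorₐ Λ (maximalIdeal_pow_succ_le O n)) =
      Ideal.Quotient.factorₐ Λ (maximalIdeal_pow_succ_le_maximalIdeal O (n + 1)) :=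
  Ideal.Quotient.factorₐ_comp Λ _ _

/-- **`O/𝔪^{n+2} → O/𝔪^{n+1}` IS A SMALL EXTENSION WITH FRAMED KERNEL** over any base ring `Λ` of the noetherian local ring
`O` ([GortzWedhorn2023] Lemma 24.72, proof: the inductive step through `A → A₀` with kernel a `κ`-vector space): there are
`d = dim_κ 𝔪^{n+1}/𝔪^{n+2}` and a `Λ`-linear framing `e : κ^d ≅ 𝔪^{n+1}/𝔪^{n+2} ⊆ O/𝔪^{n+2}` (a `κ`-basis; `𝔪` kills the
kernel) such that `(π_n, ρ_{n+1}, 𝔪^{n+1}/𝔪^{n+2}, e)` is an ★ `IsSmallExtension`: `π_n`, `ρ_{n+1}` surjective, `ker π_n` = the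
kernel ideal, `ker ρ_{n+1} = 𝔪/𝔪^{n+2}` nilpotent, `e (ρ_{n+1}(r) · v) = r · e v`. [cite: GortzWedhorn2023, Lemma 24.72 proof Step (I) (p. 409)]
[cite: StacksProject, Tag 06GD] -/
theorem exists_isSmallExtension_powQuot [IsNoetherianRing O] (n : ℕ) :
    ∃ (d : ℕ) (e : (Fin d → ResidueField O) ≃ₗ[Λ]
      ((maximalIdeal O ^ (n + 1)).map (Ideal.Quotient.mk (maximalIdeal O ^ (n + 1 + 1))))),
      IsSmallExtension (k := ResidueField O) (Ideal.Quotient.factorₐ Λ (maximalIdeal_pow_succ_le O n))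
        (Ideal.Quotient.factorₐ Λ (maximalIdeal_pow_succ_le_maximalIdeal O (n + 1)))
        ((maximalIdeal O ^ (n + 1)).map (Ideal.Quotient.mk (maximalIdeal O ^ (n + 1 + 1)))) e := by
  set I : Ideal (O ⧸ maximalIdeal O ^ (n + 1 + 1)) :=
    (maximalIdeal O ^ (n + 1)).map (Ideal.Quotient.mk (maximalIdeal O ^ (n + 1 + 1))) with hI
  -- membership in `I_n`
  have hmem : ∀ r : O, Ideal.Quotient.mk (maximalIdeal O ^ (n + 1 + 1)) r ∈ I ↔ r ∈ maximalIdeal O ^ (n + 1) :=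
    fun r => Ideal.mem_quotient_iff_mem (maximalIdeal_pow_succ_le O n)
  -- `𝔪 · I_n = 0`
  have hsmul : ∀ {r : O}, r ∈ maximalIdeal O → ∀ y : I, r • (y : O ⧸ maximalIdeal O ^ (n + 1 + 1)) = 0 := by
    intro r hr y
    obtain ⟨y, hy⟩ := y
    obtain ⟨s, rfl⟩ := Ideal.Quotient.mk_surjective y
    rw [hmem] at hy
    change Ideal.Quotient.mk _ r * Ideal.Quotient.mk _ s = 0
    rw [← map_mul, Ideal.Quotient.eq_zero_iff_mem, pow_succ']
    exact Ideal.mul_mem_mul hr hy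
  have htors : Module.IsTorsionBySet O I (maximalIdeal O) := by
    rintro y ⟨r, hr⟩
    exact Subtype.ext (hsmul hr y)
  -- the `κ`-vector space structure on `I_n`
  letI : Module (ResidueField O) I := htors.module
  haveI : IsScalarTower O (ResidueField O) I := htors.isScalarTower
  have hres : ∀ (r : O) (y : I), (residue O r) • y = r • y := fun r y => htors.mk_smul r y
  haveI : IsScalarTower Λ (ResidueField O) I :=
    ⟨fun a μ y => (congrArg (· • y) (algebraMap_smul O a μ).symm).trans
      ((smul_assoc _ _ _).trans (algebraMap_smul O a (μ • y)))⟩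
  haveI : Module.Finite O I := by
    haveI : IsNoetherianRing (O ⧸ maximalIdeal O ^ (n + 1 + 1)) := inferInstance
    haveI : Module.Finite (O ⧸ maximalIdeal O ^ (n + 1 + 1)) I := inferInstance
    exact Module.Finite.trans (O ⧸ maximalIdeal O ^ (n + 1 + 1)) I
  haveI : Module.Finite (ResidueField O) I := Module.Finite.of_restrictScalars_finite O _ _
  -- the framing by a basis
  set b := Module.finBasis (ResidueField O) I with hb
  set ρ' : O ⧸ maximalIdeal O ^ (n + 1 + 1) →ₐ[Λ] ResidueField O :=
    Ideal.Quotient.factorₐ Λ (maximalIdeal_pow_succ_le_maximalIdeal O (n + 1)) with hρ'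
  refine ⟨Module.finrank (ResidueField O) I, b.equivFun.symm.restrictScalars Λ, ?_⟩
  refine ⟨?_, ?_, ?_, ?_, ?_⟩
  · -- `π_n` surjective
    intro y
    obtain ⟨r, rfl⟩ := Ideal.Quotient.mk_surjective y
    exact ⟨Ideal.Quotient.mk _ r, rfl⟩
  · -- `ρ_{n+1}` surjective
    intro y
    obtain ⟨r, rfl⟩ := Ideal.Quotient.mk_surjective y
    exact ⟨Ideal.Quotient.mk _ r, rfl⟩
  · -- `ker π_n = I_n`
    intro y
    obtain ⟨r, rfl⟩ := Ideal.Quotient.mk_surjective y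
    rw [Ideal.Quotient.factorₐ_apply_mk, Ideal.Quotient.eq_zero_iff_mem, hmem]
  · -- `ker ρ_{n+1}` is nilpotent
    refine ⟨n + 1 + 1, ?_⟩
    have hle : RingHom.ker ρ' ≤ (maximalIdeal O).map (Ideal.Quotient.mk _) := by
      intro y hy
      obtain ⟨r, rfl⟩ := Ideal.Quotient.mk_surjective y
      refine Ideal.mem_map_of_mem _ ?_
      have hy' : (Ideal.Quotient.mk (maximalIdeal O) r : ResidueField O) = 0 := hy
      exact Ideal.Quotient.eq_zero_iff_mem.1 hy'
    rw [Submodule.zero_eq_bot, eq_bot_iff]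
    refine (Ideal.pow_right_mono hle _).trans ?_
    rw [← Ideal.map_pow, Ideal.map_quotient_self]
  · -- `e (ρ(r) · v) = r · e v`
    intro r v
    obtain ⟨r, rfl⟩ := Ideal.Quotient.mk_surjective r
    have e1 : (fun ℓ => ρ' (Ideal.Quotient.mk _ r) * v ℓ) = (residue O r) • v := by
      ext ℓ; rfl
    have h2 : b.equivFun.symm ((residue O r) • v) = (residue O r) • b.equivFun.symm v := b.equivFun.symm.map_smul _ _
    have h3 : (((residue O r) • b.equivFun.symm v : I) : O ⧸ maximalIdeal O ^ (n + 1 + 1)) =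
        Ideal.Quotient.mk _ r * (b.equivFun.symm v : O ⧸ maximalIdeal O ^ (n + 1 + 1)) := by
      have := congrArg (fun z : I => (z : O ⧸ maximalIdeal O ^ (n + 1 + 1))) (hres r (b.equivFun.symm v))
      exact this.trans (Submodule.coe_smul_of_tower _ _)
    change ((b.equivFun.symm (fun ℓ => ρ' (Ideal.Quotient.mk _ r) * v ℓ) : I) : O ⧸ maximalIdeal O ^ (n + 1 + 1)) =
      Ideal.Quotient.mk _ r * (b.equivFun.symm v : O ⧸ maximalIdeal O ^ (n + 1 + 1))
    have e2 : b.equivFun.symm (fun ℓ => ρ' (Ideal.Quotient.mk _ r) * v ℓ) = b.equivFun.symm ((residue O r) • v) :=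
      congrArg b.equivFun.symm e1
    rw [e2, h2]
    exact h3

end Literature.RingTheory.Flat

end
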